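import Summits.CriticalPhenomena.Ising3DConformalLimit.Theses.PrecisionLaplacian
import Literature.Probability.LatticeModels.GaussianPairingBoundCouplings
import Literature.LinearAlgebra.Matrix.InverseMMatrix
import HarnessLib

/-!
# Inverse-M on a finite graph and the finite-energy lower bound
# (helpers for support item `PrecisionLaplacian.InverseMCriticalKernel`)

Two finite-volume inputs of the closure lemma `InverseMCriticalKernel` (IM ⇒ the critical kernel of
`ℤ³` is a symmetric potential), for the zero-field nearest-neighbour Ising model with free boundary
condition on the WHOLE vertex set of a finite simple graph `G` (`isingTwoPoint G univ β 0 .free`):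

* `isZMatrix_inv_twoPoint_of_inverseMFerromagnet` — the route hypothesis `InverseMFerromagnet`
  (stated for sites `Fin n` and pair interactions indexed by `Fin m`) transported to an arbitrary
  finite graph: the matrix `(⟨σ_xσ_y⟩)_{x,y}` has a Z-matrix inverse. The transport is the
  naturality of `gksExpect` under relabelling of sites and interactions (`gksExpect_pair_reindex`)
  and the identification of the whole-graph free Ising weight with the pair ferromagnet
  `K ≡ β` on the edges (`isingTwoPoint_univ_free_eq_gksExpect`).
* `finiteEnergy_quadratic_lower_bound` — FINITE ENERGY: for `β ≥ 0`, every `c : V → ℝ` and every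
  site `p` of degree `≤ Δ`, `e^{-2βΔ} c_p² ≤ ∑_{x,y} c_x c_y ⟨σ_xσ_y⟩ = ⟨(∑ c_xσ_x)²⟩`
  (pair each configuration with its flip at `p`: the Boltzmann weights differ by at most `e^{2βΔ}`
  and `F(σ)² + F(σ^p)² ≥ 2c_p²`). This is the uniform positive definiteness that survives the
  thermodynamic limit.
* `sum_sum_fiber_mul`, `sum_ite_apply_eq_of_injective` — bookkeeping: a quadratic form evaluated
  on a coefficient vector pushed forward along an (injective) map of index sets.

References: Friedli–Velenik 2017, §3.8.1 (the spin systems `ν_{Λ;K}`), §3.1 eq. (3.8);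
Dellacherie–Martínez–San Martín 2014, ch. 2 (Z-matrices).
-/

namespace Summit.CriticalPhenomena.Ising3DConformalLimit.Theorems

open Literature.Probability.LatticeModels Literature.LinearAlgebra.Matrix Finset
open Summit.CriticalPhenomena.Ising3DConformalLimit.Theses.PrecisionLaplacian
open scoped Matrix

noncomputable section

/-! ## Relabelling sites and interactions in `gksExpect` -/

section Reindex

variable {V V' ι ι' : Type*} [Fintype V] [DecidableEq V] [Fintype V'] [DecidableEq V']
  [Fintype ι] [Fintype ι']

/-- Naturality of the pair expectation `⟨σ_pσ_q⟩_{Λ;K}` under a relabelling `eV` of the sites and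
`eι` of the interaction terms: transporting couplings and supports along the bijections does not
change the expectation (a change of variables `ω' = ω ∘ eV⁻¹` in both Boltzmann sums). -/
theorem gksExpect_pair_reindex (eV : V ≃ V') (eι : ι' ≃ ι) (K : ι → ℝ) (C : ι → Finset V)
    (p q : V) :
    gksExpect univ (K ∘ eι) (fun i => (C (eι i)).map eV.toEmbedding)
        (fun ω => spinAt (eV p) ω * spinAt (eV q) ω) =
      gksExpect univ K C (fun ω => spinAt p ω * spinAt q ω) := by
  -- the change of variables on configurations
  set Φ : SpinConfig V ≃ SpinConfig V' := eV.arrowCongr (Equiv.refl ℤˣ) with hΦ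
  have hΦapp : ∀ (ω : SpinConfig V) (v : V), (Φ ω) (eV v) = ω v := fun ω v => by
    simp [hΦ, Equiv.arrowCongr_apply]
  have hspin : ∀ (ω : SpinConfig V) (v : V), spinAt (eV v) (Φ ω) = spinAt v ω := fun ω v => by
    simp only [spinAt, hΦapp]
  have hprod : ∀ (ω : SpinConfig V) (j : ι),
      spinProduct ((C j).map eV.toEmbedding) (Φ ω) = spinProduct (C j) ω := fun ω j => by
    simp only [spinProduct, Finset.prod_map, Equiv.coe_toEmbedding, hspin]
  have hH : ∀ ω : SpinConfig V,
      gksHamiltonian univ (K ∘ eι) (fun i => (C (eι i)).map eV.toEmbedding) (Φ ω) =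
        gksHamiltonian univ K C ω := fun ω => by
    simp only [gksHamiltonian, Function.comp_apply, hprod]
    exact eι.sum_comp (fun j => K j * spinProduct (C j) ω)
  have hW : ∀ ω : SpinConfig V,
      gksWeight univ (K ∘ eι) (fun i => (C (eι i)).map eV.toEmbedding) (Φ ω) =
        gksWeight univ K C ω := fun ω => by
    rw [gksWeight, gksWeight, hH]
  have hnum : gksSum univ (K ∘ eι) (fun i => (C (eι i)).map eV.toEmbedding)
        (fun ω => spinAt (eV p) ω * spinAt (eV q) ω) =
      gksSum univ K C (fun ω => spinAt p ω * spinAt q ω) := by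
    unfold gksSum
    rw [← Φ.sum_comp]
    simp only [hspin, hW]
  have hden : gksSum univ (K ∘ eι) (fun i => (C (eι i)).map eV.toEmbedding) (fun _ => 1) =
      gksSum univ K C (fun _ => 1) := by
    unfold gksSum
    rw [← Φ.sum_comp]
    simp only [hW]
  rw [gksExpect, gksExpect, hnum, hden]

/-- **`InverseMFerromagnet` on an arbitrary finite index set.** The route hypothesis IM, stated
for sites `Fin n` and interactions `Fin m`, gives for every finite type of sites `V`, every finite
family of pair interactions (`|Cᵢ| = 2`, `Kᵢ ≥ 0`): the matrix of second moments
`Σ_{pq} = ⟨σ_pσ_q⟩_{Λ;K}` has a Z-matrix inverse (`Σ⁻¹_{pq} ≤ 0` for `p ≠ q`). -/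
theorem isZMatrix_inv_gksExpect_of_inverseMFerromagnet (hIM : InverseMFerromagnet)
    (K : ι → ℝ) (C : ι → Finset V) (hK : ∀ i, 0 ≤ K i) (hC : ∀ i, (C i).card = 2) :
    IsZMatrix (Matrix.of fun p q : V =>
      gksExpect univ K C (fun ω => spinAt p ω * spinAt q ω))⁻¹ := by
  set n := Fintype.card V
  set m := Fintype.card ι
  set eV : V ≃ Fin n := Fintype.equivFin V
  set eι : Fin m ≃ ι := (Fintype.equivFin ι).symm
  set M' : Matrix (Fin n) (Fin n) ℝ := Matrix.of fun p q : Fin n =>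
    gksExpect univ (K ∘ eι) (fun i => (C (eι i)).map eV.toEmbedding)
      (fun ω => spinAt p ω * spinAt q ω) with hM'
  have hIM' : ∀ x y : Fin n, x ≠ y → M'⁻¹ x y ≤ 0 :=
    hIM n m (K ∘ eι) (fun i => (C (eι i)).map eV.toEmbedding) (fun i => hK _)
      (fun i => by rw [Finset.card_map]; exact hC _)
  have hMM' : (Matrix.of fun p q : V => gksExpect univ K C (fun ω => spinAt p ω * spinAt q ω)) =
      M'.submatrix eV eV := by
    ext p q
    simp only [hM', Matrix.submatrix_apply, Matrix.of_apply]
    exact (gksExpect_pair_reindex eV eι K C p q).symm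
  intro i j hij
  rw [hMM', Matrix.inv_submatrix_equiv, Matrix.submatrix_apply]
  exact hIM' _ _ (eV.injective.ne hij)

end Reindex

/-! ## The whole-graph free Ising model as a pair ferromagnet -/

section Graph

variable {V : Type*} [Fintype V] [DecidableEq V] (G : SimpleGraph V) [DecidableRel G.Adj]

/-- The support `{z | z ∈ e}` of an edge `e = {a, b}` is the pair `{a, b}`. -/
theorem filter_mem_sym2_eq_pair (a b : V) :
    (univ.filter fun z : V => z ∈ s(a, b)) = {a, b} := by
  ext z
  simp [Sym2.mem_iff]

/-- The spin product over the support of an edge is the bond observable `σ_aσ_b`. -/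
theorem spinProduct_filter_mem_eq_bondSpin {e : Sym2 V} (he : e ∈ G.edgeFinset) (ω : SpinConfig V) :
    spinProduct (univ.filter fun z : V => z ∈ e) ω = bondSpin ω e := by
  induction e using Sym2.ind with
  | _ a b =>
    have hab : a ≠ b := G.ne_of_adj (by simpa [SimpleGraph.mem_edgeFinset] using he)
    rw [filter_mem_sym2_eq_pair, spinProduct, Finset.prod_pair hab, bondSpin_mk]

/-- The support of an edge has exactly two sites. -/
theorem card_filter_mem_edge {e : Sym2 V} (he : e ∈ G.edgeFinset) :
    (univ.filter fun z : V => z ∈ e).card = 2 := by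
  induction e using Sym2.ind with
  | _ a b =>
    have hab : a ≠ b := G.ne_of_adj (by simpa [SimpleGraph.mem_edgeFinset] using he)
    rw [filter_mem_sym2_eq_pair, Finset.card_pair hab]

/-- **The whole-graph free Ising two-point function is a pair-ferromagnet expectation**
(Friedli–Velenik 2017, §3.8.1: `μ^∅_{Λ;β,0} = ν_{Λ;K}` with `K_{{x,y}} = β` on the edges):
`⟨σ_xσ_y⟩^∅_{V;β,0} = ⟨σ_xσ_y⟩_{V;K}` with interactions indexed by the edges of `G`, `K ≡ β`,
supports the endpoint pairs. -/
theorem isingTwoPoint_univ_free_eq_gksExpect (β : ℝ) (x y : V) :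
    isingTwoPoint G univ β 0 .free x y =
      gksExpect univ (fun _ : ↥G.edgeFinset => β)
        (fun e => univ.filter fun z : V => z ∈ (e : Sym2 V))
        (fun ω => spinAt x ω * spinAt y ω) := by
  have hH : ∀ ω : SpinConfig V,
      gksHamiltonian univ (fun _ : ↥G.edgeFinset => β)
        (fun e => univ.filter fun z : V => z ∈ (e : Sym2 V)) ω =
        β * ∑ e ∈ G.edgeFinset, bondSpin ω e := fun ω => by
    rw [gksHamiltonian, Finset.mul_sum,
      ← Finset.sum_coe_sort G.edgeFinset (fun e => β * bondSpin ω e)]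
    refine Finset.sum_congr rfl fun e _ => ?_
    rw [spinProduct_filter_mem_eq_bondSpin G e.2]
  rw [isingTwoPoint, PairIsing.isingExpect_univ_free_eq_sum_div, gksExpect, gksSum, gksSum]
  simp only [gksWeight, hH, spinPair, one_mul]

/-- **IM on a finite graph.** Under `InverseMFerromagnet`, for `β ≥ 0` the matrix of two-point
functions `(⟨σ_xσ_y⟩^∅_{V;β,0})_{x,y}` of the whole-graph free Ising model has a Z-matrix inverse. -/
theorem isZMatrix_inv_twoPoint_of_inverseMFerromagnet (hIM : InverseMFerromagnet) {β : ℝ}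
    (hβ : 0 ≤ β) :
    IsZMatrix (Matrix.of fun x y : V => isingTwoPoint G univ β 0 .free x y)⁻¹ := by
  have h : (Matrix.of fun x y : V => isingTwoPoint G univ β 0 .free x y) =
      Matrix.of fun x y : V => gksExpect univ (fun _ : ↥G.edgeFinset => β)
        (fun e => univ.filter fun z : V => z ∈ (e : Sym2 V))
        (fun ω => spinAt x ω * spinAt y ω) := by
    ext x y
    simp only [Matrix.of_apply]
    exact isingTwoPoint_univ_free_eq_gksExpect G β x y
  rw [h]
  exact isZMatrix_inv_gksExpect_of_inverseMFerromagnet hIM _ _ (fun _ => hβ)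
    (fun e => card_filter_mem_edge G e.2)

/-! ## Finite energy: a uniform lower bound on the quadratic form `⟨(∑ c_xσ_x)²⟩` -/

/-- Flipping the spin at `p` changes the linear observable `F = ∑ c_xσ_x` by `-2c_pσ_p`. -/
theorem sum_mul_spinAt_update_neg (c : V → ℝ) (p : V) (σ : SpinConfig V) :
    ∑ x, c x * spinAt x (Function.update σ p (-σ p)) =
      ∑ x, c x * spinAt x σ - 2 * c p * spinAt p σ := by
  have hx : ∀ x, c x * spinAt x (Function.update σ p (-σ p)) =
      c x * spinAt x σ + (if x = p then -(2 * c p * spinAt p σ) else 0) := by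
    intro x
    by_cases h : x = p
    · subst h
      simp [spinAt, Units.val_neg]
      ring
    · simp [spinAt, h]
  simp only [hx, Finset.sum_add_distrib, Finset.sum_ite_eq', Finset.mem_univ, if_true]
  ring

/-- Flipping the spin at `p` lowers the total bond energy `∑_e σ_e` by at most `2 deg(p)`. -/
theorem sum_bondSpin_update_neg_ge (p : V) (σ : SpinConfig V) :
    ∑ e ∈ G.edgeFinset, bondSpin σ e - 2 * G.degree p ≤
      ∑ e ∈ G.edgeFinset, bondSpin (Function.update σ p (-σ p)) e := by
  have hterm : ∀ e ∈ G.edgeFinset, bondSpin σ e - 2 * (if p ∈ e then 1 else 0) ≤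
      bondSpin (Function.update σ p (-σ p)) e := by
    intro e he
    induction e using Sym2.ind with
    | _ a b =>
      have hab : a ≠ b := G.ne_of_adj (by simpa [SimpleGraph.mem_edgeFinset] using he)
      by_cases hp : p ∈ s(a, b)
      · rw [if_pos hp]
        have hle : bondSpin σ s(a, b) ≤ 1 := by
          rw [bondSpin_mk]
          have := abs_spinAt a σ
          have := abs_spinAt b σ
          nlinarith [abs_le.1 (abs_spinAt a σ).le, abs_le.1 (abs_spinAt b σ).le,
            spinAt_sq a σ, spinAt_sq b σ]
        have hflip : bondSpin (Function.update σ p (-σ p)) s(a, b) = -bondSpin σ s(a, b) := by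
          rcases Sym2.mem_iff.1 hp with rfl | rfl
          · simp [bondSpin_mk, spinAt, Function.update_of_ne (Ne.symm hab), Units.val_neg]
          · simp [bondSpin_mk, spinAt, Function.update_of_ne hab, Units.val_neg]
        rw [hflip]
        linarith
      · rw [if_neg hp]
        have ha : a ≠ p := fun h => hp (h ▸ Sym2.mem_mk_left _ _)
        have hb : b ≠ p := fun h => hp (h ▸ Sym2.mem_mk_right _ _)
        simp [bondSpin_mk, spinAt, Function.update_of_ne ha, Function.update_of_ne hb]
  have hsum := Finset.sum_le_sum hterm
  have hdeg : (∑ e ∈ G.edgeFinset, (if p ∈ e then (1 : ℝ) else 0)) = G.degree p := by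
    rw [Finset.sum_boole, ← SimpleGraph.incidenceFinset_eq_filter,
      SimpleGraph.card_incidenceFinset_eq_degree]
  rw [Finset.sum_sub_distrib, ← Finset.mul_sum, hdeg] at hsum
  exact hsum

/-- **Finite energy (uniform positive definiteness of the two-point matrix).** For the zero-field
free Ising model on a finite graph at `β ≥ 0`, every `c : V → ℝ` and every site `p` of degree at
most `Δ`: `e^{-2βΔ} c_p² ≤ ∑_{x,y} c_x c_y ⟨σ_xσ_y⟩ (= ⟨(∑_x c_xσ_x)²⟩)`. Proof: pair `σ` with its
flip `σ^p` at `p`; the weights satisfy `w(σ^p) ≥ e^{-2βΔ} w(σ)` and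
`F(σ)² + F(σ^p)² ≥ ½(F(σ) - F(σ^p))² = 2c_p²`. -/
theorem finiteEnergy_quadratic_lower_bound {β : ℝ} (hβ : 0 ≤ β) {Δ : ℕ} (p : V)
    (hp : G.degree p ≤ Δ) (c : V → ℝ) :
    Real.exp (-(2 * β * Δ)) * c p ^ 2 ≤
      ∑ x, ∑ y, c x * c y * isingTwoPoint G univ β 0 .free x y := by
  -- notation
  set W : SpinConfig V → ℝ := fun σ => Real.exp (β * ∑ e ∈ G.edgeFinset, bondSpin σ e) with hW
  set F : SpinConfig V → ℝ := fun σ => ∑ x, c x * spinAt x σ with hF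
  set Z : ℝ := ∑ σ : SpinConfig V, W σ with hZ
  have hWpos : ∀ σ, 0 < W σ := fun σ => Real.exp_pos _
  have hZpos : 0 < Z := Finset.sum_pos (fun σ _ => hWpos σ) Finset.univ_nonempty
  -- Step 1: the right-hand side is `⟨F²⟩ = (∑_σ F(σ)² W(σ)) / Z`
  have hRHS : ∑ x, ∑ y, c x * c y * isingTwoPoint G univ β 0 .free x y =
      (∑ σ : SpinConfig V, F σ ^ 2 * W σ) / Z := by
    have h1 : ∀ x y, isingTwoPoint G univ β 0 .free x y =
        (∑ σ : SpinConfig V, spinAt x σ * spinAt y σ * W σ) / Z := by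
      intro x y
      rw [isingTwoPoint, PairIsing.isingExpect_univ_free_eq_sum_div]
      rfl
    simp only [h1]
    have h2 : ∀ σ : SpinConfig V, F σ ^ 2 * W σ =
        ∑ x, ∑ y, c x * c y * (spinAt x σ * spinAt y σ * W σ) := by
      intro σ
      rw [hF, sq, Finset.sum_mul_sum, Finset.sum_mul]
      refine Finset.sum_congr rfl fun x _ => ?_
      rw [Finset.sum_mul]
      refine Finset.sum_congr rfl fun y _ => ?_
      ring
    simp only [h2]
    have h3 : ∀ x y, c x * c y * ((∑ σ : SpinConfig V, spinAt x σ * spinAt y σ * W σ) / Z) =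
        ∑ σ : SpinConfig V, c x * c y * (spinAt x σ * spinAt y σ * W σ) / Z := by
      intro x y
      rw [Finset.sum_div, Finset.mul_sum]
      refine Finset.sum_congr rfl fun σ _ => ?_
      ring
    simp only [h3]
    rw [Finset.sum_div]
    simp only [Finset.sum_div]
    calc ∑ x, ∑ y, ∑ σ : SpinConfig V, c x * c y * (spinAt x σ * spinAt y σ * W σ) / Z
        = ∑ x, ∑ σ : SpinConfig V, ∑ y, c x * c y * (spinAt x σ * spinAt y σ * W σ) / Z :=
          Finset.sum_congr rfl fun x _ => Finset.sum_comm
      _ = ∑ σ : SpinConfig V, ∑ x, ∑ y, c x * c y * (spinAt x σ * spinAt y σ * W σ) / Z :=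
          Finset.sum_comm
  rw [hRHS, le_div_iff₀ hZpos]
  -- Step 2: the flip at `p`
  set τ : SpinConfig V → SpinConfig V := fun σ => Function.update σ p (-σ p) with hτ
  have hτinv : Function.Involutive τ := by
    intro σ
    simp only [hτ]
    rw [Function.update_self, neg_neg, Function.update_idem, Function.update_eq_self]
  have hFτ : ∀ σ, F (τ σ) = F σ - 2 * c p * spinAt p σ := fun σ =>
    sum_mul_spinAt_update_neg c p σ
  have hWτ : ∀ σ, Real.exp (-(2 * β * Δ)) * W σ ≤ W (τ σ) := by
    intro σ
    rw [hW, ← Real.exp_add]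
    refine Real.exp_le_exp.2 ?_
    have h1 := sum_bondSpin_update_neg_ge G p σ
    have h2 : (G.degree p : ℝ) ≤ Δ := by exact_mod_cast hp
    nlinarith
  have hsq : ∀ σ, 2 * c p ^ 2 ≤ F σ ^ 2 + F (τ σ) ^ 2 := by
    intro σ
    rw [hFτ]
    nlinarith [spinAt_sq p σ, sq_nonneg (F σ + (F σ - 2 * c p * spinAt p σ))]
  have hexp_le_one : Real.exp (-(2 * β * Δ)) ≤ 1 := by
    rw [Real.exp_le_one_iff]
    have : (0 : ℝ) ≤ Δ := Nat.cast_nonneg _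
    nlinarith
  -- Step 3: symmetrise the Boltzmann sum over the flip and bound termwise
  have hsymm : ∑ σ : SpinConfig V, F σ ^ 2 * W σ = ∑ σ : SpinConfig V, F (τ σ) ^ 2 * W (τ σ) :=
    (Equiv.sum_comp (hτinv.toPerm τ) (fun σ => F σ ^ 2 * W σ)).symm
  have hkey : ∀ σ, 2 * (Real.exp (-(2 * β * Δ)) * c p ^ 2 * W σ) ≤
      F σ ^ 2 * W σ + F (τ σ) ^ 2 * W (τ σ) := by
    intro σ
    have hW0 : 0 ≤ W σ := (hWpos σ).le
    have hE0 : 0 ≤ Real.exp (-(2 * β * Δ)) := (Real.exp_pos _).le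
    have ha : Real.exp (-(2 * β * Δ)) * W σ * F σ ^ 2 ≤ F σ ^ 2 * W σ := by
      nlinarith [sq_nonneg (F σ), mul_le_of_le_one_left hW0 hexp_le_one]
    have hb : Real.exp (-(2 * β * Δ)) * W σ * F (τ σ) ^ 2 ≤ F (τ σ) ^ 2 * W (τ σ) := by
      nlinarith [sq_nonneg (F (τ σ)), hWτ σ]
    nlinarith [hsq σ, mul_nonneg hE0 hW0]
  have h2 : 2 * (Real.exp (-(2 * β * Δ)) * c p ^ 2 * Z) ≤ 2 * ∑ σ : SpinConfig V, F σ ^ 2 * W σ := by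
    calc 2 * (Real.exp (-(2 * β * Δ)) * c p ^ 2 * Z)
        = ∑ σ : SpinConfig V, 2 * (Real.exp (-(2 * β * Δ)) * c p ^ 2 * W σ) := by
          rw [hZ, Finset.mul_sum, Finset.mul_sum]
      _ ≤ ∑ σ : SpinConfig V, (F σ ^ 2 * W σ + F (τ σ) ^ 2 * W (τ σ)) :=
          Finset.sum_le_sum fun σ _ => hkey σ
      _ = 2 * ∑ σ : SpinConfig V, F σ ^ 2 * W σ := by
          rw [Finset.sum_add_distrib, ← hsymm, two_mul]
  linarith

end Graph

/-! ## Pushing a quadratic form forward along a map of index sets -/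

section Pushforward

/-- Pushing a coefficient vector forward along a map `f` (summing over fibres) transports the
quadratic form: `∑_{x,y} c̃_x c̃_y M_{xy} = ∑_{a,b} c_a c_b M_{f a, f b}` with
`c̃_x = ∑_{a : f a = x} c_a`. -/
theorem sum_sum_fiber_mul {α T : Type*} [Fintype α] [Fintype T] [DecidableEq T]
    (f : α → T) (c : α → ℝ) (M : T → T → ℝ) :
    ∑ x, ∑ y, (∑ a, if f a = x then c a else 0) * (∑ b, if f b = y then c b else 0) * M x y =
      ∑ a, ∑ b, c a * c b * M (f a) (f b) := by
  have inner : ∀ g : T → ℝ,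
      ∑ y, (∑ b, if f b = y then c b else 0) * g y = ∑ b, c b * g (f b) := by
    intro g
    simp only [Finset.sum_mul, ite_mul, zero_mul]
    rw [Finset.sum_comm]
    simp only [Finset.sum_ite_eq, Finset.mem_univ, if_true]
  calc ∑ x, ∑ y, (∑ a, if f a = x then c a else 0) * (∑ b, if f b = y then c b else 0) * M x y
      = ∑ x, (∑ a, if f a = x then c a else 0) *
          ∑ y, (∑ b, if f b = y then c b else 0) * M x y := by
        refine Finset.sum_congr rfl fun x _ => ?_
        rw [Finset.mul_sum]
        refine Finset.sum_congr rfl fun y _ => ?_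
        ring
    _ = ∑ x, (∑ a, if f a = x then c a else 0) * ∑ b, c b * M x (f b) := by simp only [inner]
    _ = ∑ a, c a * ∑ b, c b * M (f a) (f b) := inner (fun x => ∑ b, c b * M x (f b))
    _ = ∑ a, ∑ b, c a * c b * M (f a) (f b) := by
        refine Finset.sum_congr rfl fun a _ => ?_
        rw [Finset.mul_sum]
        refine Finset.sum_congr rfl fun b _ => ?_
        ring

/-- Along an injective `f`, the pushed-forward vector takes the value `c_p` at `f p`. -/
theorem sum_ite_apply_eq_of_injective {α T : Type*} [Fintype α] [DecidableEq α] [DecidableEq T]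
    {f : α → T} (hf : Function.Injective f) (c : α → ℝ) (p : α) :
    (∑ a, if f a = f p then c a else 0) = c p := by
  simp only [hf.eq_iff, Finset.sum_ite_eq', Finset.mem_univ, if_true]

end Pushforward

end

end Summit.CriticalPhenomena.Ising3DConformalLimit.Theorems
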